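import Literature.Analysis.FluidPDE.ClassicalNSBlowupAlternative
import Literature.Analysis.FluidPDE.H1ContinuationSobolevClass
import Literature.Analysis.FluidPDE.TaoEnstrophyLocalisationProofs
import Literature.Analysis.FluidPDE.AxisymNoSwirlTaoBounds
import HarnessLib

/-!
# Global classical solutions on `ℝ³` from an a priori enstrophy bound (the «enstrophy door» in the
# Beale–Kato–Majda class)

Analysis/FluidPDE **proofs file** (theorems only: no definitions, no named facts, no `sorry`).
The last sentence of every «a priori estimate ⇒ global regularity» argument for the unforced
Navier–Stokes system on `ℝ³`, `ν > 0`, in the class in which the tree states Beale–Kato–Majda /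
Constantin–Fefferman (classical solutions on closed slabs `[0,T] × ℝ³` with all `L²` Sobolev norms
bounded, `HasBoundedSobolevNormsOn`; data smooth, divergence free, with every derivative in `L²`):

* `exists_global_classical_of_apriori_enstrophy_bound` — IF there is `M` such that every classical
  solution `(u, p)` from `u₀` on a closed slab `[0,T]` (`T > 0`) lying in the class obeys
  `∫ |curl u(t)|² ≤ M` for all `t ∈ [0,T]`, THEN there is a classical solution on `[0,∞) × ℝ³` from
  `u₀` with bounded energy, pressure normalised by `p(t,0) = 0`, and all Sobolev norms bounded on
  every `[0,T]`.
* `exists_global_classical_of_apriori_gradient_bound` — the same door with the a priori bound on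
  the full gradient, `∫ |∇u(t)|²_F ≤ M` (lower integral), which is what Tao's `H¹` lifespan reads;
  the enstrophy form follows by the whole-space `div`–`curl` estimate.

Proof (every input a theorem of the tree). Leray's alternative for smooth finite-energy solutions
(`finiteEnergy_classical_dichotomy`: Tao 2013 Thm 5.4 / Lemma 8.1 / Cor. 11.4, RRS 2016 Thm 8.17):
either every closed slab carries a finite-energy classical solution from `u₀` — then patching
(`IsClassicalNSSolutionOn.exists_Ici_of_forall_Icc_finiteEnergy`) gives the global solution and
Tao's persistence of regularity (`…hasBoundedSobolevNormsOn_of_sobolevDatum_unforced`, Cor. 11.1)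
puts it in the class on every `[0,T]` — or a maximal finite-energy classical solution on `[0,T*)`
exists which no closed slab `[0,T]`, `T ≥ T*`, extends; it lies in the class on every
`[0,T'] ⊂ [0,T*)` (Cor. 11.1 again), so the a priori bound applies along `[0,T*)`; with the energy
bound and the whole-space `div`–`curl` estimate `∫|∇u|²_F ≤ ∫|curl u|²`
(`lintegral_frobeniusNormSq_fderiv_le_lintegral_sq_norm_curl`) this is a uniform `H¹` bound on
`[0,T*)`, whence continuation in the class past `T*` (`hasSobolevExtensionPast_of_uniform_H1_bound`:
Tao's `H¹` lifespan, Constantin–Fefferman 1993 end of proof, Lemarié-Rieusset 2016 Thm 11.7) — a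
finite-energy classical solution on `[0,T*]`, contradiction.

First consumer: the D-0090 claims cell (`Summits/…/Theorems/SoloSalvageLindgren2012Global.lean`,
C32 Step 6 «if the total enstrophy stays bounded, the solutions stay regular»), where the same
argument is written against the claim-side rendering `Literature.Claims.NS.Ruzmaikina2008.IsSolution`.

## References

* P. Constantin, C. Fefferman, Indiana Univ. Math. J. 42 (1993), 775–789, §2 (end of proof: the
  enstrophy bound implies regularity). [ConstantinFeffermanIndiana1993]
* A. J. Majda, A. L. Bertozzi, *Vorticity and Incompressible Flow*, CUP 2002, Thm 3.6 and §3.2.3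
  (continuation in `H^m`), remark p. 117 (Navier–Stokes). [MajdaBertozzi2002]
* J. Leray, Acta Math. 63 (1934), §33. [Leray1934]
* T. Tao, Anal. PDE 6 (2013) = arXiv:1108.1165, Thm 5.4, Cor. 11.1, Cor. 11.4. [Tao2011]
-/

noncomputable section

open MeasureTheory Set
open scoped ENNReal NNReal ContDiff

namespace Literature.Analysis.FluidPDE

variable {ν : ℝ} {u₀ : EuclideanSpace ℝ (Fin 3) → EuclideanSpace ℝ (Fin 3)}

/-- In the class, `∫⁻ ‖curl v‖ₑ²` is the real enstrophy `∫ ‖curl v‖²` (`curl v` continuous and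
square integrable for `v ∈ C²` with `Dv ∈ L²`). [folklore] -/
private theorem lintegral_enorm_curl_sq_eq_ofReal_integral {v : EuclideanSpace ℝ (Fin 3) → EuclideanSpace ℝ (Fin 3)}
    (hv : ContDiff ℝ 2 v) (h1 : ∫⁻ x, ‖iteratedFDeriv ℝ 1 v x‖ₑ ^ 2 < ⊤) :
    ∫⁻ x, ‖curl v x‖ₑ ^ 2 = ENNReal.ofReal (∫ x, ‖curl v x‖ ^ 2) := by
  have hint : Integrable (fun x => ‖curl v x‖ ^ 2) := (integrable_norm_curl_sq hv h1).1
  rw [ofReal_integral_eq_lintegral_ofReal hint (ae_of_all _ fun x => sq_nonneg _)]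
  refine lintegral_congr fun x => ?_
  rw [← ofReal_norm, ENNReal.ofReal_pow (norm_nonneg _)]

/-- **Global classical solutions from an a priori gradient bound** (`ℝ³`, unforced, `ν > 0`,
Beale–Kato–Majda class). Let `u₀` be smooth, divergence free, with every derivative in `L²`, and
`M ≥ 0`. Suppose that for every `T > 0` and every classical solution `(u, p)` on `[0,T] × ℝ³` with
`u(0) = u₀` and all `L²` Sobolev norms bounded on `[0,T]`, `∫ |∇u(t)|²_F ≤ M` (lower integral) for all
`t ∈ [0,T]`. Then there is a classical solution on `[0,∞) × ℝ³` with `u(0) = u₀`, bounded energy,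
`p(t,0) = 0`, and all Sobolev norms bounded on every `[0,T]`. (Leray's alternative, Tao's class and
the `H¹` continuation principle; module docstring.)
[cite: ConstantinFeffermanIndiana1993, §2 (end of proof)] [cite: MajdaBertozzi2002, Thm 3.6 and §3.2.3, remark p. 117]
[cite: Tao2011, Thm 5.4, Cor. 11.1, Cor. 11.4] -/
theorem exists_global_classical_of_apriori_gradient_bound (hν : 0 < ν) (hu₀ : ContDiff ℝ ∞ u₀)
    (hdiv : VectorCalculus.IsDivFree u₀) (hH : ∀ n : ℕ, ∫⁻ x, ‖iteratedFDeriv ℝ n u₀ x‖ₑ ^ 2 < ⊤)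
    {M : ℝ} (hM0 : 0 ≤ M)
    (hM : ∀ T : ℝ, 0 < T → ∀ (u : ℝ → EuclideanSpace ℝ (Fin 3) → EuclideanSpace ℝ (Fin 3))
      (p : ℝ → EuclideanSpace ℝ (Fin 3) → ℝ), IsClassicalNSSolutionOn (Icc 0 T) ν 0 u p → u 0 = u₀ →
        HasBoundedSobolevNormsOn (Icc 0 T) u →
          ∀ t ∈ Icc 0 T, ∫⁻ x, ENNReal.ofReal (frobeniusNormSq (fderiv ℝ (u t) x)) ≤ ENNReal.ofReal M) :
    ∃ (u : ℝ → EuclideanSpace ℝ (Fin 3) → EuclideanSpace ℝ (Fin 3))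
      (p : ℝ → EuclideanSpace ℝ (Fin 3) → ℝ),
      IsClassicalNSSolutionOn (Ici 0) ν 0 u p ∧ u 0 = u₀ ∧ HasBoundedEnergy u ∧ (∀ t, p t 0 = 0) ∧
        ∀ T : ℝ, HasBoundedSobolevNormsOn (Icc 0 T) u := by
  rcases finiteEnergy_classical_dichotomy hν hu₀ hdiv hH with hall | hbad
  · -- every closed slab carries a finite-energy classical solution: patch, and read the class off
    -- Tao's persistence of regularity
    have hH1 : MemLp (fderiv ℝ u₀) 2 volume := by
      have h1 : ∫⁻ x, ‖fderiv ℝ u₀ x‖ₑ ^ 2 < ⊤ := by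
        refine lt_of_le_of_lt (le_of_eq (lintegral_congr fun x => ?_)) (hH 1)
        rw [← ofReal_norm, ← ofReal_norm, norm_iteratedFDeriv_one]
      exact ⟨(hu₀.continuous_fderiv (by simp)).aestronglyMeasurable,
        eLpNorm_two_lt_top_of_lintegral_enorm_sq_lt_top h1⟩
    obtain ⟨u, p, hcl, hu0, ⟨E, hEtop, hEb⟩, hp0⟩ :=
      IsClassicalNSSolutionOn.exists_Ici_of_forall_Icc_finiteEnergy hν hH1 hall
    have h₀ : ∀ m : ℕ, ∫⁻ x, ‖iteratedFDeriv ℝ m (u 0) x‖ₑ ^ 2 < ⊤ := by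
      rw [hu0]; exact hH
    have key : ∀ T' : ℝ, 0 < T' → HasBoundedSobolevNormsOn (Icc 0 T') u := fun T' hT' =>
      (hcl.mono Icc_subset_Ici_self (uniqueDiffOn_Icc hT')).hasBoundedSobolevNormsOn_of_sobolevDatum_unforced
        hν hT' ⟨E.toNNReal, fun t ht => (hEb t ht.1).trans (ENNReal.coe_toNNReal hEtop.ne).ge⟩ h₀
    refine ⟨u, p, hcl, hu0, ⟨E, hEtop, hEb⟩, hp0, fun T => ?_⟩
    exact (key (max T 1) (lt_max_of_lt_right one_pos)).mono (Icc_subset_Icc_right (le_max_left _ _))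
  · -- a maximal solution with blow-up: excluded by the a priori bound
    obtain ⟨Ts, hTs, u, p, hcl, hu0, ⟨A, hAtop, hE⟩, -, hno⟩ := hbad
    exfalso
    have h₀ : ∀ m : ℕ, ∫⁻ x, ‖iteratedFDeriv ℝ m (u 0) x‖ₑ ^ 2 < ⊤ := by
      rw [hu0]; exact hH
    -- class membership on every closed sub-slab `[0, T'] ⊂ [0, T*)`
    have hsob : ∀ T' : ℝ, 0 < T' → T' < Ts → HasBoundedSobolevNormsOn (Icc 0 T') u :=
      fun T' hT' hT'T =>
        (hcl.mono (Icc_subset_Ico_right hT'T) (uniqueDiffOn_Icc hT')).hasBoundedSobolevNormsOn_of_sobolevDatum_unforced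
          hν hT' ⟨A.toNNReal, fun t ht =>
            (hE t ⟨ht.1, ht.2.trans_lt hT'T⟩).trans (ENNReal.coe_toNNReal hAtop.ne).ge⟩ h₀
    -- the a priori gradient bound along `[0, T*)`, read on the slabs `[0, (t + T*)/2]`
    have hgrad : ∀ t ∈ Ico 0 Ts,
        ∫⁻ x, ENNReal.ofReal (frobeniusNormSq (fderiv ℝ (u t) x)) ≤ ENNReal.ofReal M := by
      intro t ht
      have hT' : 0 < (t + Ts) / 2 := by linarith [ht.1]
      have htT' : t < (t + Ts) / 2 := by linarith [ht.2]
      have hT'T : (t + Ts) / 2 < Ts := by linarith [ht.2]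
      exact hM _ hT' u p (hcl.mono (Icc_subset_Ico_right hT'T) (uniqueDiffOn_Icc hT')) hu0
        (hsob _ hT' hT'T) t ⟨ht.1, htT'.le⟩
    -- the uniform `H¹` bound on `[0, T*)`
    have hA1 : ∀ t ∈ Ico 0 Ts,
        (∫⁻ x, ‖u t x‖ₑ ^ 2) + (∫⁻ x, ENNReal.ofReal (frobeniusNormSq (fderiv ℝ (u t) x))) ≤
          ENNReal.ofReal (A.toReal + M) := by
      intro t ht
      calc (∫⁻ x, ‖u t x‖ₑ ^ 2) + (∫⁻ x, ENNReal.ofReal (frobeniusNormSq (fderiv ℝ (u t) x)))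
          ≤ A + ENNReal.ofReal M := add_le_add (hE t ht) (hgrad t ht)
        _ = ENNReal.ofReal (A.toReal + M) := by
            rw [ENNReal.ofReal_add ENNReal.toReal_nonneg hM0, ENNReal.ofReal_toReal hAtop.ne]
    have hreg : ∀ T'' < Ts, HasBoundedSobolevNormsOn (Icc 0 T'') u := fun T'' hT'' =>
      (hsob (max T'' (Ts / 2)) (lt_max_of_lt_right (half_pos hTs))
        (max_lt hT'' (half_lt_self hTs))).mono (Icc_subset_Icc_right (le_max_left _ _))
    -- continuation in the class past `T*`
    obtain ⟨T', hT'Ts, v, q, hv, hvB, hagree⟩ :=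
      hasSobolevExtensionPast_of_uniform_H1_bound hν hTs hcl hreg
        (add_nonneg ENNReal.toReal_nonneg hM0) hA1
    -- its restriction to `[0, T*]` is a finite-energy classical solution from `u₀`: forbidden
    have hv0 : v 0 = u₀ := by rw [hagree 0 ⟨le_rfl, hTs⟩, hu0]
    obtain ⟨C₀, hC₀⟩ := hvB 0
    exact hno Ts le_rfl v q (hv.mono (Icc_subset_Ico_right hT'Ts) (uniqueDiffOn_Icc hTs)) hv0
      ⟨C₀, ENNReal.coe_lt_top, fun t ht => by
        rw [lintegral_enorm_sq_eq_lintegral_iteratedFDeriv_zero]; exact hC₀ t ht⟩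

/-- **Global classical solutions from an a priori enstrophy bound** (`ℝ³`, unforced, `ν > 0`,
Beale–Kato–Majda class). Let `u₀` be smooth, divergence free, with every derivative in `L²`. Suppose
there is `M` such that for every `T > 0` and every classical solution `(u, p)` on `[0,T] × ℝ³` with
`u(0) = u₀` and all `L²` Sobolev norms bounded on `[0,T]`, `∫ |curl u(t)|² ≤ M` for all `t ∈ [0,T]`.
Then there is a classical solution on `[0,∞) × ℝ³` with `u(0) = u₀`, bounded energy, `p(t,0) = 0`,
and all Sobolev norms bounded on every `[0,T]`: the gradient door after the whole-space `div`–`curl`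
estimate `∫|∇u|²_F ≤ ∫|curl u|²` (`lintegral_frobeniusNormSq_fderiv_le_lintegral_sq_norm_curl`).
(The enstrophy controls regularity: Constantin–Fefferman 1993, end of proof; Doering–Gibbon 1995
(1.4.20) for `‖∇u‖₂ = ‖curl u‖₂`.)
[cite: ConstantinFeffermanIndiana1993, §2 (end of proof)] [cite: MajdaBertozzi2002, Thm 3.6 and §3.2.3, remark p. 117]
[cite: Tao2011, Thm 5.4, Cor. 11.1, Cor. 11.4] -/
theorem exists_global_classical_of_apriori_enstrophy_bound (hν : 0 < ν) (hu₀ : ContDiff ℝ ∞ u₀)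
    (hdiv : VectorCalculus.IsDivFree u₀) (hH : ∀ n : ℕ, ∫⁻ x, ‖iteratedFDeriv ℝ n u₀ x‖ₑ ^ 2 < ⊤)
    {M : ℝ}
    (hM : ∀ T : ℝ, 0 < T → ∀ (u : ℝ → EuclideanSpace ℝ (Fin 3) → EuclideanSpace ℝ (Fin 3))
      (p : ℝ → EuclideanSpace ℝ (Fin 3) → ℝ), IsClassicalNSSolutionOn (Icc 0 T) ν 0 u p → u 0 = u₀ →
        HasBoundedSobolevNormsOn (Icc 0 T) u → ∀ t ∈ Icc 0 T, ∫ x, ‖curl (u t) x‖ ^ 2 ≤ M) :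
    ∃ (u : ℝ → EuclideanSpace ℝ (Fin 3) → EuclideanSpace ℝ (Fin 3))
      (p : ℝ → EuclideanSpace ℝ (Fin 3) → ℝ),
      IsClassicalNSSolutionOn (Ici 0) ν 0 u p ∧ u 0 = u₀ ∧ HasBoundedEnergy u ∧ (∀ t, p t 0 = 0) ∧
        ∀ T : ℝ, HasBoundedSobolevNormsOn (Icc 0 T) u := by
  -- `M ≥ 0`, read off the local solution (the hypothesis is not vacuous)
  have hM0 : 0 ≤ M := by
    obtain ⟨T₀, hT₀, u, p, hcl, hu0, A, hAtop, hE⟩ :=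
      exists_finiteEnergy_classical_Icc_of_sobolevDatum hν hu₀ hdiv hH
    have h₀ : ∀ m : ℕ, ∫⁻ x, ‖iteratedFDeriv ℝ m (u 0) x‖ₑ ^ 2 < ⊤ := by
      rw [hu0]; exact hH
    have hsob : HasBoundedSobolevNormsOn (Icc 0 T₀) u :=
      hcl.hasBoundedSobolevNormsOn_of_sobolevDatum_unforced hν hT₀
        ⟨A.toNNReal, fun t ht => (hE t ht).trans (ENNReal.coe_toNNReal hAtop.ne).ge⟩ h₀
    exact (integral_nonneg fun x => sq_nonneg _).trans (hM T₀ hT₀ u p hcl hu0 hsob 0 ⟨le_rfl, hT₀.le⟩)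
  refine exists_global_classical_of_apriori_gradient_bound hν hu₀ hdiv hH hM0
    fun T hT u p hcl hu0 hsob t ht => ?_
  have hct : ContDiff ℝ ∞ (u t) := hcl.contDiff_velocity ht
  have hct2 : ContDiff ℝ 2 (u t) := hct.of_le (by norm_cast)
  obtain ⟨C₀, hC₀⟩ := hsob 0
  obtain ⟨C₁, hC₁⟩ := hsob 1
  have hL2 : ∫⁻ x, ‖u t x‖ₑ ^ 2 < ⊤ := by
    rw [lintegral_enorm_sq_eq_lintegral_iteratedFDeriv_zero]
    exact (hC₀ t ht).trans_lt ENNReal.coe_lt_top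
  have h1t : ∫⁻ x, ‖iteratedFDeriv ℝ 1 (u t) x‖ₑ ^ 2 < ⊤ := (hC₁ t ht).trans_lt ENNReal.coe_lt_top
  calc ∫⁻ x, ENNReal.ofReal (frobeniusNormSq (fderiv ℝ (u t) x))
      ≤ ∫⁻ x, ‖curl (u t) x‖ₑ ^ 2 :=
        lintegral_frobeniusNormSq_fderiv_le_lintegral_sq_norm_curl hct2 (hcl.divFree t ht) hL2
    _ = ENNReal.ofReal (∫ x, ‖curl (u t) x‖ ^ 2) := lintegral_enorm_curl_sq_eq_ofReal_integral hct2 h1t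
    _ ≤ ENNReal.ofReal M := ENNReal.ofReal_le_ofReal (hM T hT u p hcl hu0 hsob t ht)

end Literature.Analysis.FluidPDE

end
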